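import Literature.AlgebraicGeometry.HodgeTheory.HodgeTypePullbackVanishing
import Literature.AlgebraicGeometry.HodgeTheory.GysinFormalismPushforward
import Literature.NumberTheory.Transcendental.AnalytificationChartsProofs
import Literature.Analysis.Complex.InjectiveHolomorphic
import HarnessLib

/-!
# `τ^an` is immersive where `τ` is surjective on stalks (GAGA, §2 n°5–6)

Family `hodge`, layer `Literature/AlgebraicGeometry/HodgeTheory`. Theorems-only file (no definitions,
no named facts; D-0026). J.-P. Serre, *Géométrie algébrique et géométrie analytique* (1956), §2 n°6
Prop. 3 Cor. 2 with §1 n°4: at a simple point the algebraic local coordinates are holomorphic local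
coordinates of `X^h`, so a morphism which is a closed immersion near a point has immersive
analytification there. On the tree's carriers — Hodge models `A` of `Y`, `B` of `V` (smooth
projective), the holomorphic map `τ^an = HodgeModel.anMap A B τ : V^an → Y^an` of
`HodgeTypePullbackVanishing` — this file proves:

* `HodgeModel.injective_mfderiv_anMap_of_forall_exists_eval_eq` — **if at the complex point
  `P = φ_B(b₀)` every regular function on an affine neighbourhood of `P` takes, at the complex points of
  a Zariski neighbourhood of `P`, the values `r(τ Q)` of a regular function `r` on an affine open of `Y`,
  then `d(τ^an)(b₀)` is injective.** Proof: a holomorphic ALGEBRAIC chart `c` of `V(ℂ)` at `P`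
  (`exists_algebraicChart_holds`, Serre §2 n°5 Prop. 2) has regular coordinates, so `c ∘ φ_B` is
  holomorphic (`IsAnalytification.mdifferentiableOn_evalOrZero`) and injective near `b₀`, hence has
  bijective differential by the Clements–Osgood theorem
  (`Literature.Analysis.Complex.SCV.bijective_fderiv_of_injOn`); near `b₀` its coordinates factor as
  `(r_t ∘ φ_A) ∘ τ^an` with `r_t ∘ φ_A` holomorphic on `Y^an`, whence `d(c ∘ φ_B) = d(r ∘ φ_A) ∘ dτ^an`.
* `exists_eval_eq_of_stalkMap_surjective` — the hypothesis holds at every `P` where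
  `𝒪_{Y, τP} → 𝒪_{V, P}` is surjective (germs, `TopCat.Presheaf.germ_eq`, and the naturality of
  evaluation at complex points `AlgPoints.eval_map`);
* `stalkMap_comp_surjective_of_isIso_morphismRestrict` — which is the case for `τ = π ≫ ι`, `ι` a
  closed immersion and `π` an isomorphism over an open `U ∋ π P` (a resolution of singularities of a
  closed subvariety, read in the ambient variety, over its isomorphism locus).

Consumer: the non-vanishing of the fundamental class of a subvariety (discharge programme of the
named fact `map_fundamentalClass_ne_zero_of_height_eq`, `AlgebraicClassesHodgeType`): at such a point
the restricted Fubini–Study form `θ_{τ ≫ κ} = (τ^an)^* θ_κ` is positive definite.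

## References

* [SerreGAGA1956] J.-P. Serre, GAGA, Ann. Inst. Fourier 6 (1956), §1 n°4, §2 n°5 (Lemme 1, Prop. 2),
  n°6 (Prop. 3, Cor. 2).
* [FritzscheGrauert2002] K. Fritzsche, H. Grauert, From Holomorphic Functions to Complex Manifolds
  (2002), Ch. I §8 Thm. 8.5 (injective holomorphic maps).
* [Hartshorne1977] R. Hartshorne, Algebraic Geometry (1977), II §2 (stalks of morphisms), II Ex. 2.7,
  Ex. 3.11.
-/

noncomputable section

open scoped Manifold ContDiff Topology
open CategoryTheory AlgebraicGeometry Set Filter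
open Literature.NumberTheory.Transcendental
open Literature.AlgebraicGeometry.Motives (ComplexPoints AlgPoints)

namespace Literature.AlgebraicGeometry.HodgeTheory

section HodgeTheory

variable {n d : ℕ} {Y V : Motives.SchemeOver ℂ}

namespace HodgeModel

/-- **`τ^an` is an immersion at a point where every germ of regular function is pulled back from the
target** (Serre, GAGA §2 n°5–6: at a simple point the regular functions contain local holomorphic
coordinates). Let `V`, `Y` be smooth projective with Hodge models `B`, `A`, `τ : V ⟶ Y`, and `b₀` a
point of `V^an` over `P = φ_B(b₀) ∈ V(ℂ)` such that every regular function `s` on an affine open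
`U ∋ P` agrees, at the complex points of a Zariski neighbourhood `N` of `P`, with `r ∘ τ` for a regular
function `r` on an affine open `O` of `Y` (this holds where `τ` restricts to a closed immersion into an
open subscheme of `Y`). Then the differential of `τ^an = anMap A B τ : V^an → Y^an` at `b₀` is
injective. Proof: a holomorphic algebraic chart `c` of `V(ℂ)` at `P` (`exists_algebraicChart_holds`)
has regular coordinates `x_t ∈ Γ(V, U)`, so `ẽ = c ∘ φ_B` is holomorphic and injective near `b₀`,
hence has bijective differential (Clements–Osgood, `SCV.bijective_fderiv_of_injOn`); and near `b₀`,
`ẽ_t = (r_t ∘ φ_A) ∘ τ^an` with `r_t ∘ φ_A` holomorphic on `Y^an`, so `dẽ = d(r ∘ φ_A) ∘ dτ^an` and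
`dτ^an(b₀)` is injective. [cite: SerreGAGA1956, §2 n°5 Lemme 1 c), Prop. 2 and n°6 Prop. 3 Cor. 2] -/
theorem injective_mfderiv_anMap_of_forall_exists_eval_eq (A : HodgeModel n Y) (B : HodgeModel d V)
    (hY : Motives.IsSmoothProjective n Y) (hV : Motives.IsSmoothProjective d V) (τ : V ⟶ Y)
    (b₀ : B.carrier)
    (hlift : ∀ (U : V.left.affineOpens) (s : Γ(V.left, ↑U)),
      (B.toComplexPoints b₀).pt ∈ (↑U : V.left.Opens) →
      ∃ (O : Y.left.affineOpens) (r : Γ(Y.left, ↑O)) (N : V.left.Opens),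
        (B.toComplexPoints b₀).pt ∈ N ∧
        ∀ Q : ComplexPoints V, Q.pt ∈ N →
          (AlgPoints.map τ Q).pt ∈ (↑O : Y.left.Opens) ∧
          AlgPoints.evalOrZero (↑U : V.left.Opens) s Q =
            AlgPoints.evalOrZero (↑O : Y.left.Opens) r (AlgPoints.map τ Q)) :
    Function.Injective (mfderiv 𝓘(ℂ, B.model) 𝓘(ℂ, A.model) (anMap A B τ) b₀) := by
  classical
  -- instances
  haveI : LocallyOfFiniteType V.hom := locallyOfFiniteType_of_isSmoothProjective hV
  haveI := hV.smoothOfRelativeDimension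
  haveI : CompleteSpace B.model := FiniteDimensional.complete ℂ B.model
  haveI : CompleteSpace A.model := FiniteDimensional.complete ℂ A.model
  -- notation
  set φB := B.toComplexPoints with hφB
  set φA := A.toComplexPoints with hφA
  set F : B.carrier → A.carrier := anMap A B τ with hFdef
  set P : ComplexPoints V := φB b₀ with hPdef
  have hFd : MDifferentiable 𝓘(ℂ, B.model) 𝓘(ℂ, A.model) F := mdifferentiable_anMap A B τ hV hY
  -- an algebraic chart of `V(ℂ)` at `P`
  obtain ⟨c, hPc, ⟨U, x, hsrcU, hcx⟩, -⟩ := exists_algebraicChart_holds V d P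
  -- the lifts of the coordinates
  choose O r N hPN hN using fun t : Fin d ↦ hlift U (x t) (hsrcU hPc)
  -- the charts of the models at `b₀` and `F b₀`
  set ψ := extChartAt 𝓘(ℂ, B.model) b₀ with hψ
  set ψA := extChartAt 𝓘(ℂ, A.model) (F b₀) with hψA
  set z₀ : B.model := ψ b₀ with hz₀
  -- the chart `ẽ = c ∘ φ_B` read in `ψ`: `G = c ∘ φ_B ∘ ψ⁻¹`
  set G : B.model → (Fin d → ℂ) := fun z ↦ c (φB (ψ.symm z)) with hG
  -- its domain
  set Ω : Set B.carrier := φB ⁻¹' c.source with hΩ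
  have hΩo : IsOpen Ω := c.open_source.preimage B.isAnalytification.isHomeomorph.continuous
  have hb₀Ω : b₀ ∈ Ω := hPc
  set W : Set B.model := ψ.target ∩ ψ.symm ⁻¹' (Ω ∩ ψ.source) with hW
  have hWo : IsOpen W := by
    refine (continuousOn_extChartAt_symm b₀).isOpen_inter_preimage (isOpen_extChartAt_target b₀) ?_
    exact hΩo.inter (isOpen_extChartAt_source b₀)
  have hz₀W : z₀ ∈ W := by
    refine ⟨mem_extChartAt_target b₀, ?_⟩
    change ψ.symm (ψ b₀) ∈ Ω ∩ ψ.source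
    rw [extChartAt_to_inv]
    exact ⟨hb₀Ω, mem_extChartAt_source b₀⟩
  -- `G` is holomorphic on `W`
  have hGd : DifferentiableOn ℂ G W := by
    refine differentiableOn_pi.2 fun t ↦ ?_
    have h1 : MDifferentiableOn 𝓘(ℂ, B.model) 𝓘(ℂ, ℂ)
        (fun b ↦ AlgPoints.evalOrZero (↑U : V.left.Opens) (x t) (φB b))
        (φB ⁻¹' {Q | Q.pt ∈ (↑U : V.left.Opens)}) :=
      B.isAnalytification.mdifferentiableOn_evalOrZero U (x t)
    have h2 : MDifferentiableOn 𝓘(ℂ, B.model) 𝓘(ℂ, ℂ)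
        ((fun b ↦ AlgPoints.evalOrZero (↑U : V.left.Opens) (x t) (φB b)) ∘ ψ.symm) W := by
      refine h1.comp ((mdifferentiableOn_extChartAt_symm (I := 𝓘(ℂ, B.model)) (x := b₀)).mono
        Set.inter_subset_left) ?_
      rintro z ⟨-, hzΩ, -⟩
      exact hsrcU hzΩ
    have h3 : DifferentiableOn ℂ
        ((fun b ↦ AlgPoints.evalOrZero (↑U : V.left.Opens) (x t) (φB b)) ∘ ψ.symm) W :=
      mdifferentiableOn_iff_differentiableOn.1 h2
    refine h3.congr fun z hz ↦ ?_
    obtain ⟨-, hzΩ, -⟩ := hz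
    exact hcx _ hzΩ t
  -- `G` is injective on `W`
  have hGinj : InjOn G W := by
    rintro z ⟨hzt, hzΩ, -⟩ z' ⟨hz't, hz'Ω, -⟩ h
    have h1 : φB (ψ.symm z) = φB (ψ.symm z') := c.injOn hzΩ hz'Ω h
    have h2 : ψ.symm z = ψ.symm z' := B.isAnalytification.isHomeomorph.injective h1
    exact ψ.symm.injOn hzt hz't h2
  -- Clements–Osgood: `dG(z₀)` is injective
  have hdim : Module.finrank ℂ B.model = Module.finrank ℂ (Fin d → ℂ) := by
    rw [B.isAnalytification.finrank_eq, Module.finrank_fin_fun]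
  have hGi : Function.Injective (fderiv ℂ G z₀) :=
    (Literature.Analysis.Complex.SCV.bijective_fderiv_of_injOn hdim hGd hWo hGinj hz₀W).1
  -- the factorisation `G = R ∘ (ψ_A ∘ F ∘ ψ⁻¹)` near `z₀`
  set R : A.model → (Fin d → ℂ) := fun w t ↦
    AlgPoints.evalOrZero (↑(O t) : Y.left.Opens) (r t) (φA (ψA.symm w)) with hR
  set Fc : B.model → A.model := fun z ↦ ψA (F (ψ.symm z)) with hFc
  have hFc_eq : Fc = writtenInExtChartAt 𝓘(ℂ, B.model) 𝓘(ℂ, A.model) b₀ F := rfl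
  -- `F b₀` lies over `τ P`
  have hFP : φA (F b₀) = AlgPoints.map τ P := toComplexPoints_anMap A B τ b₀
  -- `R` is differentiable at `w₀ = ψ_A (F b₀)`
  have hRd : DifferentiableAt ℂ R (ψA (F b₀)) := by
    refine differentiableAt_pi.2 fun t ↦ ?_
    have h1 : MDifferentiableOn 𝓘(ℂ, A.model) 𝓘(ℂ, ℂ)
        (fun a ↦ AlgPoints.evalOrZero (↑(O t) : Y.left.Opens) (r t) (φA a))
        (φA ⁻¹' {Q | Q.pt ∈ (↑(O t) : Y.left.Opens)}) :=
      A.isAnalytification.mdifferentiableOn_evalOrZero (O t) (r t)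
    have hmem : F b₀ ∈ φA ⁻¹' {Q | Q.pt ∈ (↑(O t) : Y.left.Opens)} := by
      change (φA (F b₀)).pt ∈ (↑(O t) : Y.left.Opens)
      rw [hFP]
      exact (hN t P (hPN t)).1
    have hopen : IsOpen (φA ⁻¹' {Q : ComplexPoints Y | Q.pt ∈ (↑(O t) : Y.left.Opens)}) :=
      A.isAnalytification.isOpen_preimage _
    have h2 : MDifferentiableAt 𝓘(ℂ, A.model) 𝓘(ℂ, ℂ)
        (fun a ↦ AlgPoints.evalOrZero (↑(O t) : Y.left.Opens) (r t) (φA a)) (F b₀) :=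
      h1.mdifferentiableAt (hopen.mem_nhds hmem)
    have h3 := h2.differentiableWithinAt_writtenInExtChartAt
    rw [ModelWithCorners.Boundaryless.range_eq_univ, differentiableWithinAt_univ] at h3
    exact h3
  -- `Fc` is differentiable at `z₀`
  have hFcd : DifferentiableAt ℂ Fc z₀ := by
    have h3 := (hFd b₀).differentiableWithinAt_writtenInExtChartAt
    rw [ModelWithCorners.Boundaryless.range_eq_univ, differentiableWithinAt_univ] at h3
    exact h3
  -- the factorisation holds near `z₀`
  have hNopen : IsOpen {Q : ComplexPoints V | ∀ t, Q.pt ∈ N t} := by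
    rw [Set.setOf_forall]
    exact isOpen_iInter_of_finite fun t ↦ AlgPoints.isOpen_setOf_pt_mem _
  set T : Set B.carrier := (Ω ∩ ψ.source) ∩
    (φB ⁻¹' {Q | ∀ t, Q.pt ∈ N t} ∩ F ⁻¹' ψA.source) with hT
  have hTo : IsOpen T :=
    (hΩo.inter (isOpen_extChartAt_source b₀)).inter
      ((hNopen.preimage B.isAnalytification.isHomeomorph.continuous).inter
        ((isOpen_extChartAt_source (F b₀)).preimage (continuous_anMap A B τ)))
  have hb₀T : b₀ ∈ T :=
    ⟨⟨hb₀Ω, mem_extChartAt_source b₀⟩, fun t ↦ hPN t, mem_extChartAt_source (F b₀)⟩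
  set S : Set B.model := ψ.target ∩ ψ.symm ⁻¹' T with hS
  have hSo : IsOpen S :=
    (continuousOn_extChartAt_symm b₀).isOpen_inter_preimage (isOpen_extChartAt_target b₀) hTo
  have hz₀S : z₀ ∈ S := by
    refine ⟨mem_extChartAt_target b₀, ?_⟩
    change ψ.symm (ψ b₀) ∈ T
    rw [extChartAt_to_inv]
    exact hb₀T
  have hGRF : G =ᶠ[𝓝 z₀] R ∘ Fc := by
    refine Filter.eventuallyEq_of_mem (hSo.mem_nhds hz₀S) ?_
    rintro z ⟨-, ⟨hzΩ, -⟩, hzN, hzA⟩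
    funext t
    change c (φB (ψ.symm z)) t =
      AlgPoints.evalOrZero (↑(O t) : Y.left.Opens) (r t) (φA (ψA.symm (ψA (F (ψ.symm z)))))
    rw [hcx _ hzΩ t, ψA.left_inv hzA,
      show φA (F (ψ.symm z)) = AlgPoints.map τ (φB (ψ.symm z)) from toComplexPoints_anMap A B τ _]
    exact (hN t _ (hzN t)).2
  -- chain rule
  have hFcz₀ : Fc z₀ = ψA (F b₀) := by
    change ψA (F (ψ.symm (ψ b₀))) = _
    rw [extChartAt_to_inv]
  have hcomp : fderiv ℂ G z₀ = (fderiv ℂ R (Fc z₀)).comp (fderiv ℂ Fc z₀) := by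
    rw [hGRF.fderiv_eq]
    refine fderiv_comp z₀ ?_ hFcd
    rw [hFcz₀]
    exact hRd
  have hFci : Function.Injective (fderiv ℂ Fc z₀) := by
    intro u v huv
    apply hGi
    rw [hcomp, ContinuousLinearMap.comp_apply, ContinuousLinearMap.comp_apply, huv]
  -- `mfderiv F b₀ = fderiv Fc z₀`
  have hmf : mfderiv 𝓘(ℂ, B.model) 𝓘(ℂ, A.model) F b₀ = fderiv ℂ Fc z₀ := by
    rw [(hFd b₀).mfderiv, ModelWithCorners.Boundaryless.range_eq_univ, fderivWithin_univ]
    rfl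
  rw [hmf]
  exact hFci

end HodgeModel

/-! ### Germs pulled back from the target: the hypothesis at a point where `τ` is surjective on stalks -/

/-- **Where `τ` is surjective on the stalk, every regular function near `P` is pulled back from
`Y`, at the level of values at complex points.** For `τ : V ⟶ Y`, a complex point `P` of `V` with
`𝒪_{Y, τ P} → 𝒪_{V, P}` surjective (e.g. `τ` a closed immersion near `P`, or an isomorphism onto a
closed subscheme over a neighbourhood of `τ P`), an affine open `U ∋ P` and `s ∈ Γ(V, U)`: there are
an affine open `O ∋ τ P` of `Y`, `r ∈ Γ(Y, O)` and a Zariski neighbourhood `N` of `P` with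
`s(Q) = r(τ Q)` for all complex points `Q` of `N` (germs: `s_P = τ^*(r_{τP})`, and equal germs agree on a
neighbourhood). This is the hypothesis `hlift` of
`HodgeModel.injective_mfderiv_anMap_of_forall_exists_eval_eq`. [cite: Hartshorne1977, II §2 (stalks) and II Ex. 2.7] -/
theorem exists_eval_eq_of_stalkMap_surjective (τ : V ⟶ Y) (P : ComplexPoints V)
    (hτ : Function.Surjective (τ.left.stalkMap P.pt)) (U : V.left.affineOpens)
    (s : Γ(V.left, ↑U)) (hPU : P.pt ∈ (↑U : V.left.Opens)) :
    ∃ (O : Y.left.affineOpens) (r : Γ(Y.left, ↑O)) (N : V.left.Opens),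
      P.pt ∈ N ∧
      ∀ Q : ComplexPoints V, Q.pt ∈ N →
        (AlgPoints.map τ Q).pt ∈ (↑O : Y.left.Opens) ∧
        AlgPoints.evalOrZero (↑U : V.left.Opens) s Q =
          AlgPoints.evalOrZero (↑O : Y.left.Opens) r (AlgPoints.map τ Q) := by
  -- the germ of `s` comes from a germ `g` on `Y`, represented on an open `O₁`
  obtain ⟨g, hg⟩ := hτ (V.left.presheaf.germ (↑U) P.pt hPU s)
  obtain ⟨O₁, hyO₁, r₁, rfl⟩ := Y.left.presheaf.exists_germ_eq g
  -- shrink to an affine open `O`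
  obtain ⟨O, hOaff, hyO, hOO₁⟩ : ∃ O : Y.left.Opens, O ∈ Y.left.affineOpens ∧
      τ.left.base P.pt ∈ O ∧ O ≤ O₁ :=
    (TopologicalSpace.Opens.isBasis_iff_nbhd.1 Y.left.isBasis_affineOpens) hyO₁
  set r : Γ(Y.left, O) := Y.left.presheaf.map (homOfLE hOO₁).op r₁ with hr
  -- equality of germs at `P`
  have hgerm : V.left.presheaf.germ (τ.left ⁻¹ᵁ O) P.pt hyO (τ.left.app O r) =
      V.left.presheaf.germ ↑U P.pt hPU s := by
    rw [← hg]
    have h1 : (τ.left.stalkMap P.pt) (Y.left.presheaf.germ O₁ (τ.left.base P.pt) hyO₁ r₁) =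
        V.left.presheaf.germ (τ.left ⁻¹ᵁ O₁) P.pt hyO₁ (τ.left.app O₁ r₁) := by
      rw [← CommRingCat.comp_apply, Scheme.Hom.germ_stalkMap, CommRingCat.comp_apply]
    rw [h1, hr]
    have h2 : τ.left.app O (Y.left.presheaf.map (homOfLE hOO₁).op r₁) =
        V.left.presheaf.map (homOfLE (τ.left.preimage_mono hOO₁)).op (τ.left.app O₁ r₁) := by
      rw [← CommRingCat.comp_apply, ← CommRingCat.comp_apply, τ.left.naturality]
      rfl
    rw [h2, TopCat.Presheaf.germ_res_apply]
  obtain ⟨N, hPN, iO, iU, hres⟩ := TopCat.Presheaf.germ_eq V.left.presheaf P.pt hyO hPU _ _ hgerm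
  refine ⟨⟨O, hOaff⟩, r, N, hPN, fun Q hQ ↦ ⟨iO.le hQ, ?_⟩⟩
  have hQU : Q.pt ∈ (↑U : V.left.Opens) := iU.le hQ
  have hQO : (AlgPoints.map τ Q).pt ∈ O := iO.le hQ
  have a1 : Q.eval N hQ (V.left.presheaf.map iU.op s) = Q.eval ↑U hQU s :=
    AlgPoints.eval_res Q iU.le hQ s
  have a2 : Q.eval N hQ (V.left.presheaf.map iO.op (τ.left.app O r)) =
      Q.eval (τ.left ⁻¹ᵁ O) hQO (τ.left.app O r) :=
    AlgPoints.eval_res Q iO.le hQ _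
  rw [AlgPoints.evalOrZero_of_mem _ hQU, AlgPoints.evalOrZero_of_mem _ hQO, AlgPoints.eval_map,
    ← a1, ← a2, hres]


/-- **Over the isomorphism locus of `π`, the composite `π ≫ ι` with a closed immersion `ι` is
surjective on stalks**: for `π : X' ⟶ X₀` an isomorphism over the open `U ⊆ X₀`, `ι : X₀ ⟶ Y` a
closed immersion and `p ∈ π⁻¹U`, `𝒪_{Y, ι π p} → 𝒪_{X', p}` is onto (`ι` is surjective on stalks,
Mathlib `IsClosedImmersion`; `π` induces isomorphisms of stalks over `U`). The situation of a
resolution of singularities read in the ambient variety. [cite: Hartshorne1977, II §2 and II Ex. 3.11] -/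
theorem stalkMap_comp_surjective_of_isIso_morphismRestrict {X' X₀ Z : Scheme} (π : X' ⟶ X₀)
    (ι : X₀ ⟶ Z) [IsClosedImmersion ι] (U : X₀.Opens) [IsIso (π ∣_ U)] (p : X')
    (hp : p ∈ π ⁻¹ᵁ U) : Function.Surjective ((π ≫ ι).stalkMap p) := by
  haveI : IsIso (π.stalkMap p) :=
    ((MorphismProperty.isomorphisms CommRingCat).arrow_mk_iso_iff
      (morphismRestrictStalkMap π U ⟨p, hp⟩)).mp
        ((MorphismProperty.isomorphisms.iff _).mpr inferInstance)
  rw [Scheme.Hom.stalkMap_comp]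
  intro t
  obtain ⟨u, rfl⟩ := (ConcreteCategory.bijective_of_isIso (π.stalkMap p)).2 t
  obtain ⟨v, rfl⟩ := ι.stalkMap_surjective (π.base p) u
  exact ⟨v, rfl⟩

end HodgeTheory

end Literature.AlgebraicGeometry.HodgeTheory

end
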